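import Summits.Ventures.HSemireg.WedgeHankelRecurrenceGaussChebyshevSResultantClosed
import Literature.Algebra.Polynomial.ChebyshevChains

/-!
# Venture HSemireg — **THE RESULTANT OF TWO VIETA–LUCAS ∕ DICKSON POLYNOMIALS OVER EVERY COMMUTATIVE RING: `Res_{(m,n)}(C_m, C_n) = 0` IF `m ∕ gcd`, `n ∕ gcd` ARE BOTH ODD, AND
# `= (−1)^{mn∕2} · 2^{gcd(m,n)}` OTHERWISE** (Mathlib's monic `C_n(x) = 2 T_n(x∕2)`, `C_0 = 2`): the monic shadow of N461 — all of `2^{mn+gcd−m−n}` but `2^{gcd}` was leading coefficients, and the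
# surviving `2^{gcd}` is `Res(C_g, C_0) = Res(C_g, 2) = 2^g` at the bottom of the descent; Euclidean steps `Res_{(m,j+2m)}(C_m, C_{j+2m}) = (−1)^m Res_{(m,j)}(C_m, C_j)` and the reflection,
# from Mathlib's `C_m C_k = C_{m+k} + C_{m−k}`

HONEST FRAMING. Part of the Lean index of the computation cell `pub-hsemireg` (seat p10 gen 48, Sunday typer «UNIFORM-IN-n»).  Polynomial ∕ resultant algebra and `ℕ`-parity bookkeeping only; no
variety, no cohomology theory, no sheaf, no Ext group and no semiregularity map is constructed here; nothing here says that HC / HC_CM / HC_AV holds; no Literature fact (unproved `Prop`) is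
declared or used (the Literature import supplies the THEOREM `monic_chebyshevC_and_natDegree`).  Custodian versions as in `WedgeHankelSiegelIdeal` (1/3).
SOURCES (cited).  K. Dilcher, K. B. Stolarsky, Trans. Amer. Math. Soc. 357 (2005) 965–981, Thm 3.3 and §4 (Dickson ∕ `C`-normalisation); R. Lidl, G. L. Mullen, G. Turnwald, *Dickson Polynomials* (1993),
Ch. 2; T. J. Rivlin, *Chebyshev Polynomials* (1974), Ex. 1.5.31.
PROOF TYPED HERE.  `Literature…ChebyshevChains.monic_chebyshevC_and_natDegree` (imported); N458 bookkeeping (`exists_fold_mod_two_mul` pattern, `gcd_eq_and_odd_div_iff_of_eq_add ∕ _of_add_eq`); N461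
`even_mul_of_not_odd_odd`; Mathlib `C_mul_C`, `C_neg`, `C_zero`, `resultant_add_mul_right`, `resultant_add_right_deg`, `resultant_C_mul_right`, `resultant_comm`, `resultant_self_eq_zero`,
`resultant_C_zero_left ∕ _right`.
DEDUP DISCLOSURE (`rg -n 'chebyshevC_natDegree_le|chebyshevC_resultant' Summits Literature HarnessLib`, 2026-09-04): 0 hits for the 7 names below.

WHAT IS IN THE TREE.  N458, N461, N466; Literature `ChebyshevChains`.
THIS FILE (namespace `Summit.Ventures.HSemireg.Wedge.HankelOuter` continued; CHAINED on N468; 0 definitions):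
* §1234 `chebyshevC_natDegree_le`, `chebyshevC_resultant_of_rel`, **`chebyshevC_resultant_add_two_mul`**, **`chebyshevC_resultant_reflect`**, `chebyshevC_resultant_closed_descent`,
  **`chebyshevC_resultant_closed`**, `chebyshevC_resultant_closed_int`.
CAVEATS.  `mn ∕ 2` is `ℕ`-division (exact whenever the resultant is non-zero).  Formal degrees explicit.  Nothing Ext-side.  New names only.
-/

open Module Polynomial
open scoped Matrix Polynomial

namespace Summit.Ventures.HSemireg.Wedge.HankelOuter

/-! ## §1234. `Res(C_m, C_n)` in closed form -/

/-- `deg C_n ≤ n` (`n ∈ ℕ`, nontrivial ring; `C_0 = 2`). [bookkeeping; this file, §1234] -/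
theorem chebyshevC_natDegree_le {R : Type*} [CommRing R] [Nontrivial R] (n : ℕ) : (Polynomial.Chebyshev.C R (n : ℤ)).natDegree ≤ n := by
  rcases n with _ | k
  · rw [Nat.cast_zero, Polynomial.Chebyshev.C_zero, show (2 : R[X]) = Polynomial.C 2 from (Polynomial.C_ofNat 2).symm, natDegree_C]
  · exact (Literature.Algebra.Polynomial.ChebyshevChains.monic_chebyshevC_and_natDegree (R := R) k).2.le

/-- Resultant bookkeeping: if `C_n = −C_j + C_{m+1} C_i` with `i + (m+1) ≤ n = j + k`, then `Res_{(m+1,n)}(C_{m+1}, C_n) = (−1)^{m+1} Res_{(m+1,j)}(C_{m+1}, C_j)` (monic: no power of the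
leading coefficient). [this file, §1234] -/
theorem chebyshevC_resultant_of_rel {R : Type*} [CommRing R] [Nontrivial R] {m j i n k : ℕ}
    (hrel : Polynomial.Chebyshev.C R (n : ℤ) = -Polynomial.Chebyshev.C R (j : ℤ) + Polynomial.Chebyshev.C R ((m + 1 : ℕ) : ℤ) * Polynomial.Chebyshev.C R (i : ℤ))
    (hdeg : i + (m + 1) ≤ n) (hk : n = j + k) :
    (Polynomial.Chebyshev.C R ((m + 1 : ℕ) : ℤ)).resultant (Polynomial.Chebyshev.C R (n : ℤ)) (m + 1) n =
      (-1) ^ (m + 1) * (Polynomial.Chebyshev.C R ((m + 1 : ℕ) : ℤ)).resultant (Polynomial.Chebyshev.C R (j : ℤ)) (m + 1) j := by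
  obtain ⟨hmonic, hdegC⟩ := Literature.Algebra.Polynomial.ChebyshevChains.monic_chebyshevC_and_natDegree (R := R) m
  have hcoeff : (Polynomial.Chebyshev.C R ((m + 1 : ℕ) : ℤ)).coeff (m + 1) = 1 := by
    have h := hmonic.coeff_natDegree
    rwa [hdegC] at h
  have hf : (Polynomial.Chebyshev.C R ((m + 1 : ℕ) : ℤ)).natDegree ≤ m + 1 := hdegC.le
  have hp : (Polynomial.Chebyshev.C R (i : ℤ)).natDegree + (m + 1) ≤ n := (Nat.add_le_add_right (chebyshevC_natDegree_le i) _).trans hdeg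
  have hg : (-Polynomial.Chebyshev.C R (j : ℤ)).natDegree ≤ j := by rw [natDegree_neg]; exact chebyshevC_natDegree_le j
  rw [hrel, Polynomial.resultant_add_mul_right _ _ _ _ _ hp hf, hk, Polynomial.resultant_add_right_deg _ _ _ _ k hg, hcoeff,
    show -Polynomial.Chebyshev.C R (j : ℤ) = Polynomial.C (-1 : R) * Polynomial.Chebyshev.C R (j : ℤ) by rw [C_neg, C_1, neg_one_mul], Polynomial.resultant_C_mul_right]
  ring

/-- **EUCLIDEAN STEP I: `Res_{(m+1, j+2(m+1))}(C_{m+1}, C_{j+2(m+1)}) = (−1)^{m+1} Res_{(m+1, j)}(C_{m+1}, C_j)`** (every nontrivial commutative ring). [this file, §1234] -/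
theorem chebyshevC_resultant_add_two_mul {R : Type*} [CommRing R] [Nontrivial R] (m j : ℕ) :
    (Polynomial.Chebyshev.C R ((m + 1 : ℕ) : ℤ)).resultant (Polynomial.Chebyshev.C R ((j + 2 * (m + 1) : ℕ) : ℤ)) (m + 1) (j + 2 * (m + 1)) =
      (-1) ^ (m + 1) * (Polynomial.Chebyshev.C R ((m + 1 : ℕ) : ℤ)).resultant (Polynomial.Chebyshev.C R (j : ℤ)) (m + 1) j := by
  refine chebyshevC_resultant_of_rel (i := j + (m + 1)) ?_ (by omega) rfl
  have h := Polynomial.Chebyshev.C_mul_C R ((m + 1 : ℕ) : ℤ) ((j + (m + 1) : ℕ) : ℤ)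
  rw [show ((m + 1 : ℕ) : ℤ) + ((j + (m + 1) : ℕ) : ℤ) = ((j + 2 * (m + 1) : ℕ) : ℤ) by push_cast; ring,
    show ((m + 1 : ℕ) : ℤ) - ((j + (m + 1) : ℕ) : ℤ) = -(j : ℤ) by push_cast; ring, Polynomial.Chebyshev.C_neg] at h
  linear_combination (-1 : R[X]) * h

/-- **EUCLIDEAN STEP II (REFLECTION): for `j + i = m+1`, `Res_{(m+1, j+2i)}(C_{m+1}, C_{j+2i}) = (−1)^{m+1} Res_{(m+1, j)}(C_{m+1}, C_j)`.** [this file, §1234] -/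
theorem chebyshevC_resultant_reflect {R : Type*} [CommRing R] [Nontrivial R] {m j i : ℕ} (hji : j + i = m + 1) :
    (Polynomial.Chebyshev.C R ((m + 1 : ℕ) : ℤ)).resultant (Polynomial.Chebyshev.C R ((j + 2 * i : ℕ) : ℤ)) (m + 1) (j + 2 * i) =
      (-1) ^ (m + 1) * (Polynomial.Chebyshev.C R ((m + 1 : ℕ) : ℤ)).resultant (Polynomial.Chebyshev.C R (j : ℤ)) (m + 1) j := by
  refine chebyshevC_resultant_of_rel (i := i) (k := 2 * i) ?_ (by omega) rfl
  have h := Polynomial.Chebyshev.C_mul_C R ((m + 1 : ℕ) : ℤ) (i : ℤ)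
  rw [show ((m + 1 : ℕ) : ℤ) + (i : ℤ) = ((j + 2 * i : ℕ) : ℤ) by push_cast; linarith,
    show ((m + 1 : ℕ) : ℤ) - (i : ℤ) = (j : ℤ) by push_cast; linarith] at h
  linear_combination (-1 : R[X]) * h

/-- The descent: for `1 ≤ m < n`, the closed form at all `(m, j)` with `j < n` gives it at `(m, n)`. [this file, §1234] -/
theorem chebyshevC_resultant_closed_descent {R : Type*} [CommRing R] [Nontrivial R] {m n : ℕ} (hm : 0 < m) (hmn : m < n)
    (ih : ∀ j < n, (Polynomial.Chebyshev.C R (m : ℤ)).resultant (Polynomial.Chebyshev.C R (j : ℤ)) m j =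
      if Odd (m / Nat.gcd m j) ∧ Odd (j / Nat.gcd m j) then 0 else (-1) ^ (m * j / 2) * 2 ^ Nat.gcd m j) :
    (Polynomial.Chebyshev.C R (m : ℤ)).resultant (Polynomial.Chebyshev.C R (n : ℤ)) m n =
      if Odd (m / Nat.gcd m n) ∧ Odd (n / Nat.gcd m n) then 0 else (-1) ^ (m * n / 2) * 2 ^ Nat.gcd m n := by
  obtain ⟨m, rfl⟩ : ∃ m', m = m' + 1 := ⟨m - 1, by omega⟩
  rcases Nat.lt_or_ge n (2 * (m + 1)) with h2 | h2
  · -- reflection: `n = j + 2i`, `j + i = m + 1`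
    obtain ⟨i, j, rfl, hji⟩ : ∃ i j, n = j + 2 * i ∧ j + i = m + 1 := ⟨n - (m + 1), 2 * (m + 1) - n, by omega, by omega⟩
    obtain ⟨hg, hodd⟩ := gcd_eq_and_odd_div_iff_of_add_eq (m := m + 1) (n := j + 2 * i) (j := j) (q := 1) (by omega)
    rw [chebyshevC_resultant_reflect hji, ih j (by omega), hg]
    by_cases hP : Odd ((m + 1) / Nat.gcd (m + 1) j) ∧ Odd (j / Nat.gcd (m + 1) j)
    · rw [if_pos hP, if_pos (show _ ∧ _ from ⟨hP.1, hodd.2 hP.2⟩), mul_zero]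
    · rw [if_neg hP, if_neg (fun h => hP ⟨h.1, hodd.1 h.2⟩)]
      have hev : Even ((m + 1) * j) := even_mul_of_not_odd_odd hP
      have hdiv : (m + 1) * (j + 2 * i) / 2 = (m + 1) * j / 2 + (m + 1) * i := by
        rw [show (m + 1) * (j + 2 * i) = (m + 1) * j + 2 * ((m + 1) * i) by ring, Nat.add_mul_div_left _ _ (by norm_num : 0 < 2)]
      have hsgn : ((-1 : R)) ^ ((m + 1) * i) = (-1) ^ (m + 1) := by
        rcases Nat.even_or_odd (m + 1) with h | h
        · rw [Even.neg_one_pow h, Even.neg_one_pow (h.mul_right _)]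
        · have hj : Even j := ((Nat.even_mul.1 hev).resolve_left (Nat.not_even_iff_odd.2 h))
          have hi : Odd i := by
            by_contra hi
            rw [Nat.not_odd_iff_even] at hi
            exact (Nat.not_even_iff_odd.2 h) (hji ▸ hj.add hi)
          rw [Odd.neg_one_pow h, Odd.neg_one_pow (h.mul hi)]
      rw [hdiv, pow_add (-1 : R) ((m + 1) * j / 2) ((m + 1) * i), hsgn]
      ring
  · -- shift: `n = j + 2(m+1)`
    obtain ⟨j, rfl⟩ : ∃ j, n = j + 2 * (m + 1) := ⟨n - 2 * (m + 1), by omega⟩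
    obtain ⟨hg, hodd⟩ := gcd_eq_and_odd_div_iff_of_eq_add (m := m + 1) (n := j + 2 * (m + 1)) (j := j) (q := 1) (by ring)
    rw [chebyshevC_resultant_add_two_mul, ih j (by omega), hg]
    by_cases hP : Odd ((m + 1) / Nat.gcd (m + 1) j) ∧ Odd (j / Nat.gcd (m + 1) j)
    · rw [if_pos hP, if_pos (show _ ∧ _ from ⟨hP.1, hodd.2 hP.2⟩), mul_zero]
    · rw [if_neg hP, if_neg (fun h => hP ⟨h.1, hodd.1 h.2⟩)]
      have hdiv : (m + 1) * (j + 2 * (m + 1)) / 2 = (m + 1) * j / 2 + (m + 1) * (m + 1) := by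
        rw [show (m + 1) * (j + 2 * (m + 1)) = (m + 1) * j + 2 * ((m + 1) * (m + 1)) by ring, Nat.add_mul_div_left _ _ (by norm_num : 0 < 2)]
      have hsgn : ((-1 : R)) ^ ((m + 1) * (m + 1)) = (-1) ^ (m + 1) := by
        rcases Nat.even_or_odd (m + 1) with h | h
        · rw [Even.neg_one_pow h, Even.neg_one_pow (h.mul_right _)]
        · rw [Odd.neg_one_pow h, Odd.neg_one_pow (h.mul h)]
      rw [hdiv, pow_add (-1 : R) ((m + 1) * j / 2) ((m + 1) * (m + 1)), hsgn]
      ring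

/-- **`Res_{(m,n)}(C_m, C_n) = 0` if `m ∕ gcd(m,n)` and `n ∕ gcd(m,n)` are both odd, and `= (−1)^{mn∕2} · 2^{gcd(m,n)}` otherwise, for all `m, n ∈ ℕ` and EVERY commutative ring**
(Vieta–Lucas ∕ Dickson polynomials `C_n(x) = 2 T_n(x∕2)`, `C_0 = 2`). [Dilcher–Stolarsky 2005 (monic form of Thm 3.3); this file, §1234] -/
theorem chebyshevC_resultant_closed {R : Type*} [CommRing R] (m n : ℕ) :
    (Polynomial.Chebyshev.C R (m : ℤ)).resultant (Polynomial.Chebyshev.C R (n : ℤ)) m n =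
      if Odd (m / Nat.gcd m n) ∧ Odd (n / Nat.gcd m n) then 0 else (-1) ^ (m * n / 2) * 2 ^ Nat.gcd m n := by
  nontriviality R
  obtain ⟨s, hs⟩ : ∃ s, m + n = s := ⟨_, rfl⟩
  induction s using Nat.strong_induction_on generalizing m n with
  | _ s ih =>
  rcases Nat.eq_zero_or_pos m with rfl | hm
  · rw [Nat.cast_zero, Polynomial.Chebyshev.C_zero, show (2 : R[X]) = Polynomial.C 2 from (Polynomial.C_ofNat 2).symm, Polynomial.resultant_C_zero_left]
    simp
  rcases Nat.eq_zero_or_pos n with rfl | hn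
  · rw [Nat.cast_zero, Polynomial.Chebyshev.C_zero, show (2 : R[X]) = Polynomial.C 2 from (Polynomial.C_ofNat 2).symm, Polynomial.resultant_C_zero_right]
    simp
  rcases lt_trichotomy m n with hlt | rfl | hgt
  · exact chebyshevC_resultant_closed_descent hm hlt (fun j _ => ih (m + j) (by omega) m j rfl)
  · obtain ⟨k, rfl⟩ : ∃ k, m = k + 1 := ⟨m - 1, by omega⟩
    have hdeg := (Literature.Algebra.Polynomial.ChebyshevChains.monic_chebyshevC_and_natDegree (R := R) k).2
    have h0 := Polynomial.resultant_self_eq_zero (Polynomial.Chebyshev.C R ((k + 1 : ℕ) : ℤ)) (by rw [hdeg]; omega)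
    rw [hdeg] at h0
    rw [h0, Nat.gcd_self, Nat.div_self hm, if_pos ⟨odd_one, odd_one⟩]
  · rw [Polynomial.resultant_comm, chebyshevC_resultant_closed_descent hn hgt (fun j _ => ih (n + j) (by omega) n j rfl), Nat.gcd_comm n m]
    by_cases hP : Odd (m / Nat.gcd m n) ∧ Odd (n / Nat.gcd m n)
    · rw [if_pos hP, if_pos (show _ ∧ _ from ⟨hP.2, hP.1⟩), mul_zero]
    · rw [if_neg hP, if_neg (fun h => hP ⟨h.2, h.1⟩), mul_comm n m, Even.neg_one_pow (even_mul_of_not_odd_odd hP), one_mul]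

/-- The integer instance: `Res_{(m,n)}(C_m, C_n) ∈ {0, ±2^{gcd(m,n)}}` over `ℤ`. [this file, §1234] -/
theorem chebyshevC_resultant_closed_int (m n : ℕ) :
    (Polynomial.Chebyshev.C ℤ (m : ℤ)).resultant (Polynomial.Chebyshev.C ℤ (n : ℤ)) m n =
      if Odd (m / Nat.gcd m n) ∧ Odd (n / Nat.gcd m n) then 0 else (-1) ^ (m * n / 2) * 2 ^ Nat.gcd m n :=
  chebyshevC_resultant_closed m n

end Summit.Ventures.HSemireg.Wedge.HankelOuter
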